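import Literature.MathematicalPhysics.QuantumFieldTheory.Balaban1983to89.B16LargeFieldFactors380
import Literature.MathematicalPhysics.QuantumFieldTheory.Balaban1983to89.B16Sect1SmallFactors

/-!
# `T4Continuum.Spine.NE7c.LiveFactorLargeField` — spine estimate NE7c (node U5b), road (δ) THRESHOLD RANDOMISATION:
# the (L1-step) robustness census's ONE LOSS CLASS (C1: the large-field factors of [B16] §1 carry `λ²` when a LIVE
# threshold is lowered by the common factor `λ ∈ [λ₀, 1]`) IN KERNEL FORM, against the tree's AS-PRINTED leaves for
# [B16] pp. 380–383 (cell `pub-balaban-gaps`, track G2, seat ne8 gen 2; record `HOME/ne/NE7c.md` §7 rows 14 ∕ 16 ∕ 17)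

HONEST FRAMING.  Finite four-torus programme, rung (B)+1 only — NOT infinite volume, NOT a mass gap, NOT the Clay
problem, NOT summit progress, NOT a proof of NE7c (`T4IndicatorShell.ShellWeightBound`, INSTANCE 0∕1, which waits on
node O).  Nothing of [Bałaban 1983–89] is asserted beyond print: every input below is an explicit hypothesis of the
tree's quoted leaves (`B16LargeFieldFactors380`, `B16Sect1Statements` §12, `B16Sect1Kernels` §§3∕6∕7), and what is PROVED
is real arithmetic about those displays.  This file does NOT verify that C1 is the census's only loss class (the
completeness of the (L1-step) census over [B14]–[B16] is NOT PRINTED, GAPS G-ne7cp1-2; the cell's two-reader census is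
`HOME/ne/NE7c.md` §7).  Spine PROVED 0∕9 — unchanged by this file.

WHAT ROAD (δ) ASKS OF PRINT HERE (record t4/T4-EST-NE7c-P1 §3 (δ), `T4ShellMeasureSocket` §1–§2: the `∀ c` binders).
Member (δ-1) of `T4ShellMeasure` §8e replaces, at the LIVE levels of one run, every small-field threshold of [B15] (1.3)–
(1.9) ∕ [B14] (2.17) — `ε_j`, `δ_j`, `δ′_j` and the auxiliaries proportional to them — by `λ·ε_j`, `λ·δ_j`, `λ·δ′_j` with
ONE common factor `λ ∈ [λ₀, 1]`, `λ₀ = 1 − β′ > 0`.  In the [III] (2.2)–(2.4) dictionary `ε_j = g_jA₀p₀(g_j)`,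
`δ_j = g_jA₁p₀(g_j)`, `δ′_j = g_jA₁p₁(g_j)` this is LITERALLY the substitution `(A₀, A₁) ↦ (λA₀, λA₁)` at that level
(`live_dictionary`).  The printed large-field bookkeeping of [B16] pp. 380–383 consumes the amplitudes only through
(i) RATIO relations (`2B₃²A₁² ≦ A₀²`, `8B₃²(1+β₀)²A₁² ≦ A₀²`, `4·O(1)B₃M²·A₁² ≦ A₀²` — cell ledger GAPS G-B16-07 R2∕R3),
which are HOMOGENEOUS, hence invariant under the substitution, and (ii) «g_j sufficiently small» clauses in which `A₁²`
multiplies a GROWING profile (`4 ≦ γ₀A₁²p₀(g_j)`, the p. 383 display's `12(d+3)(…)^{d+2} < γ₀A₁²R_j³`, the exponent proviso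
«2p₁ − (d + 5)r₀ > p₀»), which survive with `λ₀²A₁²` for `A₁²` at the price of a smaller `g_j` DEPENDING ON `λ₀` ONLY.
OUTPUT: every kept factor of print holds at a live level VERBATIM IN `p₀(g_j)` and with `A₁ ↦ λ₀A₁` in the Gaussian
amplitudes — uniformly in `λ ∈ [λ₀, 1]` (indeed in any per-threshold factor `μ ∈ [λ₀, 1]`, so mixed live∕dead windows
`j − N ≦ m ≦ j` are covered with `μ = 1` at dead levels).

WHAT IS HERE (all PROVED; `Lit.` = `Literature.MathematicalPhysics.QuantumFieldTheory.Balaban1983to89`).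
* §1 `live_dictionary` — `μ·(g·A·p) = g·(μA)·p`; `ratio_live`, `clause_live`, `clause_of_g_small` (homogeneous
  relations are invariant, «g small» clauses are asked once at `λ₀` and hold below an explicit `g₀(λ₀)`); `liveProfile_antitone` + `cross_level_coeff_le` = census class C6″ (the
  cross-level coefficient of [B15] (1.46) carries `λ_j/λ_i ≤ 1` under member (δ-1): no room consumed).
* §2 p. 381, the three preparatory factors (`Lit.B16Sect1Statements.prep381_chi_n ∕ prep381_chi' ∕ prep381_chiΛ`) with
  the threshold scaled by `μ ≥ λ ≥ 0`: `…_live` versions, conclusions `exp(−λ²A₁²p₀²(g_j))`, `exp(−γ₀λ²A₁²p₁²(g_j))`.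
* §3 pp. 380–381, the fundamental factor of a component (`Lit.B16LargeFieldFactors380.fundamentalFactor_le`) with
  `ε_j, δ_j` scaled by `μ ∈ [λ₀, 1]`: `fundamentalFactor_le_live`, conclusion
  `exp(−½γ₀(λ₀A₁)²p₀²(g_j)(d′ + 1) − 2p₀(g_j))` under `2B₃²A₁² ≦ A₀²` (unchanged) and `4 ≦ γ₀(λ₀A₁)²p₀(g_j)`.
* §4 p. 383: the display after (1.78) with the selected bond's threshold `μ·A₁p₁(g_j)` (`lfFactor178_live` — print's
  largeness hypothesis is `λ`-FREE), and the exponent proviso's ABSORPTION of `μ² ≥ λ₀²` together with the amplitudes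
  `A₀, A₁` and the (2.5) bracket `ℓ^{r₀} ≦ R_j ≦ Lℓ^{r₀}` (`margin383_live`: `p₀(g_j) ≦ R_j^{−d−5}(μp₁(g_j))²` once
  `A₀L^{d+5} ≦ λ₀²A₁²ℓ^{σ}`, `σ = 2p₁ − (d+5)r₀ − p₀ > 0`, `ℓ = log g_j⁻²`; `ir383_of_ell_ge`: the closed-form infrared
  threshold `ℓ ≧ (A₀L^{d+5}∕(λ₀²A₁²))^{1∕σ}`), and the HEADLINE in print's letters `liveFactor383_of_g_small`: for (2.5)'s
  `R_j` (`Lit.B14.IsRj`) and the profiles `Lit.p0Profile`, ∃ g₀(λ₀) > 0 such that for all `0 < g_j ≦ g₀` and ALL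
  `μ ≥ λ₀`: `exp(−R_j^{−d−5}(μ·p₁(g_j))²) ≦ exp(−p₀(g_j))` — «and we estimate the factors by exp(−p₀(g_j))», read with the
  live factor.  (The abstract profile form of the same absorption, `p < q` natural exponents, is
  `Lit.T4ShellMeasureSocket.exp_liveFactor_le_exp`; this file is its junction with the as-printed p. 383 leaves.)
* §5 sanity: the proviso is inhabited (`d = 4`: `p₀ = 2 < 2·6 − 9·1`).
NOT HERE: census class C8 (the lower bound on a threshold-RESTRICTED Gaussian normalisation, [B16] p. 358 ∕ p. 380 —
a separate measure-theoretic leaf), classes C2–C7∕C9 (gains ∕ invariants ∕ free constants — nothing to prove at this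
grain), the convention item C5′, node O, U1b's two-run rate, (W1).  No `def … : Prop` hypothesis is minted; 0 sorry.
-/

namespace Summit.QuantumFields.BalabanUV.T4Continuum.Spine.NE7c.LiveFactorLargeField

open Literature.MathematicalPhysics.QuantumFieldTheory.Balaban1983to89
open B13ScaleTransfer TreeLength B16LargeFieldFactors380 B16Sect1Statements B16Sect1Kernels

noncomputable section

/-! ## §1. The live dictionary: scaling a threshold = scaling its amplitude -/

/-- Road (δ)'s live factor acts on the [III] (2.2)–(2.4) dictionary by scaling the AMPLITUDE: `μ·(g·A·p) = g·(μA)·p`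
(`ε_j = g_jA₀p₀(g_j) ↦ λε_j = g_j(λA₀)p₀(g_j)`, likewise `δ_j`, `δ′_j`). [folklore] -/
theorem live_dictionary (μ g A p : ℝ) : μ * (g * A * p) = g * (μ * A) * p := by ring

/-- A ratio relation `c·A₁² ≦ A₀²` between the amplitudes is invariant under the live substitution
`(A₀, A₁) ↦ (μA₀, μA₁)` (census classes C4∕C7: homogeneous relations consume no room). [folklore] -/
theorem ratio_live {c A₀ A₁ : ℝ} (μ : ℝ) (h : c * A₁ ^ 2 ≤ A₀ ^ 2) : c * (μ * A₁) ^ 2 ≤ (μ * A₀) ^ 2 := by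
  have hμ : 0 ≤ μ ^ 2 := sq_nonneg μ
  nlinarith [mul_le_mul_of_nonneg_left h hμ]

/-- A «g small» clause `c ≦ K·A₁²·P` (with `K, P ≥ 0`) stated for the amplitude `λ₀A₁` implies it for every `μA₁`,
`μ ≥ λ₀ ≥ 0` (census class C1: the clause is asked ONCE, at the bottom of the live factor's range).  The clauses of this
shape in the tree's [B16] §1 leaves: `4 ≦ γ₀A₁²p₀(g_j)` (`Lit.B16LargeFieldFactors380.display381`, §3 below), the located
condition of the (1.80)-induction's creation step «¼γ₀(14)^{−d}A₁²p₀²(g₁) ≧ O(1)2(64)^dM^dL^{d+1}R₁^{d+2}»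
(`Lit.B16Lem384Induction.Birth.hcond : 2Q ≤ a`, `a = ¼γ₀(14)^{−d}A₁²p₀²`, p. 385 «satisfied for p₀ large, and g₁
sufficiently small») and (1.85)'s `γ₀A₁²p₀²(g_{j+1})` — so the κ-induction downstream of §3 runs unchanged at the
amplitude `λ₀A₁` once its clause is certified there. [folklore] -/
theorem clause_live {c K A₁ P lam₀ μ : ℝ} (hK : 0 ≤ K) (hP : 0 ≤ P) (h0 : 0 ≤ lam₀) (hμ : lam₀ ≤ μ)
    (h : c ≤ K * (lam₀ * A₁) ^ 2 * P) : c ≤ K * (μ * A₁) ^ 2 * P := by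
  have h1 : (lam₀ * A₁) ^ 2 ≤ (μ * A₁) ^ 2 := by
    rw [mul_pow, mul_pow]
    exact mul_le_mul_of_nonneg_right (pow_le_pow_left₀ h0 hμ 2) (sq_nonneg _)
  exact h.trans (mul_le_mul_of_nonneg_right (mul_le_mul_of_nonneg_left h1 hK) hP)

/-- … and such a clause IS satisfiable «for g_j sufficiently small» depending on `λ₀` only: for `K > 0`, `A > 0` and a
profile exponent `p ≥ 1`, `c ≤ K·(λ₀A′)²·(A(log g⁻²)^p)` holds for all `0 < g ≤ exp(−ℓ₀∕2)` with the explicit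
`ℓ₀ = max 1 (c ∕ (K(λ₀A′)²A))` (`Lit.p0Profile A p g = A(log g⁻²)^p`). [folklore] -/
theorem clause_of_g_small {c K A A' lam₀ : ℝ} {p : ℕ} (hK : 0 < K) (hA : 0 < A) (hA' : A' ≠ 0) (h0 : 0 < lam₀)
    (hp : 1 ≤ p) {g : ℝ} (hg0 : 0 < g)
    (hg : g ≤ Real.exp (-(max 1 (c / (K * (lam₀ * A') ^ 2 * A)) / 2))) :
    c ≤ K * (lam₀ * A') ^ 2 * p0Profile A p g := by
  have hℓ : max 1 (c / (K * (lam₀ * A') ^ 2 * A)) ≤ Real.log (g ^ 2)⁻¹ :=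
    B16Sect1SmallFactors.ell_ge_of_g_le hg0 hg
  have hℓ1 : 1 ≤ Real.log (g ^ 2)⁻¹ := le_trans (le_max_left _ _) hℓ
  have hW : 0 < K * (lam₀ * A') ^ 2 * A := by positivity
  have h1 : c / (K * (lam₀ * A') ^ 2 * A) ≤ Real.log (g ^ 2)⁻¹ := le_trans (le_max_right _ _) hℓ
  have h2 : Real.log (g ^ 2)⁻¹ ≤ (Real.log (g ^ 2)⁻¹) ^ p := by
    calc Real.log (g ^ 2)⁻¹ = (Real.log (g ^ 2)⁻¹) ^ 1 := (pow_one _).symm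
      _ ≤ (Real.log (g ^ 2)⁻¹) ^ p := pow_le_pow_right₀ hℓ1 hp
  rw [div_le_iff₀ hW] at h1
  unfold p0Profile
  calc c ≤ Real.log (g ^ 2)⁻¹ * (K * (lam₀ * A') ^ 2 * A) := h1
    _ ≤ (Real.log (g ^ 2)⁻¹) ^ p * (K * (lam₀ * A') ^ 2 * A) := mul_le_mul_of_nonneg_right h2 hW.le
    _ = K * (lam₀ * A') ^ 2 * (A * (Real.log (g ^ 2)⁻¹) ^ p) := by ring

/-- Member (δ-1)'s per-level factor — `λ` on the LIVE levels `j ≥ j₀` (the youngest ones, `j₀ = K − N₁` for the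
comparison `K`), `1` on the older ones — is positive and ANTITONE in the level. [folklore] -/
theorem liveProfile_antitone (j₀ : ℕ) {lam : ℝ} (h0 : 0 < lam) (h1 : lam ≤ 1) :
    Antitone (fun j : ℕ => if j₀ ≤ j then lam else 1) ∧ ∀ j, 0 < (if j₀ ≤ j then lam else 1) := by
  refine ⟨fun i j hij => ?_, fun j => ?_⟩
  · dsimp only
    by_cases hi : j₀ ≤ i
    · rw [if_pos hi, if_pos (hi.trans hij)]
    · rw [if_neg hi]
      split_ifs
      · exact h1
      · exact le_rfl
  · split_ifs
    · exact h0
    · exact one_pos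

/-- Census class C6″ (record `HOME/ne/NE7c.md` §7 row 10) in kernel form: a CROSS-LEVEL coefficient of [B15] (1.46) —
the current level's `δ′_j = g_jA₁p₁(g_j)` re-expressed in units of an OLDER level's `ε_i`, `i ≤ j`
(`Lit.B15Ineq146Proof.ineq146_of_145`) — picks up the ratio `Λ j / Λ i` of the two levels' live factors; for an antitone
positive profile `Λ` (member (δ-1), `liveProfile_antitone`) this ratio is `≤ 1`, so the coefficient does not grow and
print's free constant `α` ([B15] p. 186 «αβ, where an absolute constant α will be chosen later») is NOT consumed.  Only
the stage-wise member (δ-stages), whose factors are not ordered by level, pays here. [folklore] -/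
theorem cross_level_coeff_le {Λ : ℕ → ℝ} (hanti : Antitone Λ) (hpos : ∀ j, 0 < Λ j) {i j : ℕ} (hij : i ≤ j)
    {c : ℝ} (hc : 0 ≤ c) : c * Λ j / Λ i ≤ c := by
  rw [div_le_iff₀ (hpos i)]
  exact mul_le_mul_of_nonneg_left (hanti hij) hc

/-! ## §2. p. 381: the three preparatory large-field factors with a live threshold -/

/-- **[B16] p. 381, the factor from `1 − χ_j^{(n)}`, LIVE**: with the regularity threshold `ε_m` of the level `m`
(`j − N ≦ m ≦ j`) multiplied by `μ ∈ [λ, 1]` (`μ = λ` if `m` is live, `μ = 1` if not), the printed chain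
`exp(−¼(1∕g_m²)B₃⁻²·½(με_m)²) ≦ exp(−⅛B₃⁻²(1+β₀)⁻²(μA₀)²p₀²(g_j)) ≦ exp(−(μA₁)²p₀²(g_j))`
(`Lit.B16Sect1Statements.prep381_chi_n` at the amplitudes `(μA₀, μA₁)`; the ledger relation R2 is homogeneous) ends in
`exp(−λ²A₁²p₀²(g_j))`.  Inputs exactly print's (`hε`, `hp`, `hR2`) plus `0 ≦ λ ≦ μ`. [folklore] -/
theorem prep381_chi_n_live {gm B₃ εm A₀ p₀gm p₀gj β₀ A₁ lam μ : ℝ} (hgm : gm ≠ 0) (hB₃ : B₃ ≠ 0)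
    (hε : εm = gm * A₀ * p₀gm) (hβ : 0 ≤ β₀) (hp0 : 0 ≤ p₀gj) (hp : (1 + β₀)⁻¹ * p₀gj ≤ p₀gm)
    (hR2 : 8 * B₃ ^ 2 * (1 + β₀) ^ 2 * A₁ ^ 2 ≤ A₀ ^ 2) (hlam : 0 ≤ lam) (hμ : lam ≤ μ) :
    Real.exp (-(1 / 4 * (1 / gm ^ 2) * (B₃ ^ 2)⁻¹ * (1 / 2) * (μ * εm) ^ 2)) ≤
      Real.exp (-(lam ^ 2 * (A₁ ^ 2 * p₀gj ^ 2))) := by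
  have hε' : μ * εm = gm * (μ * A₀) * p₀gm := by rw [hε]; ring
  obtain ⟨h1, h2⟩ := prep381_chi_n (A₁ := μ * A₁) hgm hB₃ hε' hβ hp0 hp (ratio_live μ hR2)
  refine h1.trans (h2.trans (Real.exp_le_exp.mpr (neg_le_neg ?_)))
  have hsq : lam ^ 2 ≤ μ ^ 2 := pow_le_pow_left₀ hlam hμ 2
  have h0 : 0 ≤ A₁ ^ 2 * p₀gj ^ 2 := by positivity
  calc lam ^ 2 * (A₁ ^ 2 * p₀gj ^ 2) ≤ μ ^ 2 * (A₁ ^ 2 * p₀gj ^ 2) := mul_le_mul_of_nonneg_right hsq h0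
    _ = (μ * A₁) ^ 2 * p₀gj ^ 2 := by ring

/-- **[B16] p. 381, the factor from `1 − χ′_m`, LIVE**: with the fluctuation threshold `δ′_m` multiplied by
`μ ∈ [λ, 1]`, the printed chain (`Lit.B16Sect1Statements.prep381_chi'` at the amplitude `μA₁`) ends in
`exp(−γ₀λ²A₁²p₁²(g_j))`. [folklore] -/
theorem prep381_chi'_live {γ₀ gm δ'm A₁ p₁gm p₁gj β₀ lam μ : ℝ} (hgm : gm ≠ 0) (hγ : 0 ≤ γ₀)
    (hδ : δ'm = gm * A₁ * p₁gm) (hβ0 : 0 ≤ β₀) (hβ1 : β₀ ≤ 1) (hp0 : 0 ≤ p₁gj)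
    (hp : (1 + β₀)⁻¹ * p₁gj ≤ p₁gm) (hlam : 0 ≤ lam) (hμ : lam ≤ μ) :
    Real.exp (-(γ₀ * (1 / gm ^ 2) * (2 * (μ * δ'm)) ^ 2)) ≤
      Real.exp (-(lam ^ 2 * (γ₀ * A₁ ^ 2 * p₁gj ^ 2))) := by
  have hδ' : μ * δ'm = gm * (μ * A₁) * p₁gm := by rw [hδ]; ring
  obtain ⟨h1, h2⟩ := prep381_chi' (A₁ := μ * A₁) hgm hγ hδ' hβ0 hβ1 hp0 hp
  refine h1.trans (h2.trans (Real.exp_le_exp.mpr (neg_le_neg ?_)))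
  have hsq : lam ^ 2 ≤ μ ^ 2 := pow_le_pow_left₀ hlam hμ 2
  have h0 : 0 ≤ γ₀ * A₁ ^ 2 * p₁gj ^ 2 := by positivity
  calc lam ^ 2 * (γ₀ * A₁ ^ 2 * p₁gj ^ 2) ≤ μ ^ 2 * (γ₀ * A₁ ^ 2 * p₁gj ^ 2) :=
      mul_le_mul_of_nonneg_right hsq h0
    _ = γ₀ * (μ * A₁) ^ 2 * p₁gj ^ 2 := by ring

/-- **[B16] p. 381, the factor from `1 − χ_{j,Λ}`, LIVE** ([B15] p. 193: the failed regularity test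
`|V_k(∂p′) − 1| ≧ (O(1)B₃M²)⁻¹ε_k` at the lowered threshold `με_j`): the printed bound
(`Lit.B16Sect1Statements.prep381_chiΛ` at `(μA₀, μA₁)`; R3 `4KA₁² ≦ A₀²` homogeneous) ends in `exp(−λ²A₁²p₀²(g_j))`.
[folklore] -/
theorem prep381_chiΛ_live {gj K εj A₀ p₀gj A₁ lam μ : ℝ} (hgj : gj ≠ 0) (hK : 0 < K) (hε : εj = gj * A₀ * p₀gj)
    (hR3 : 4 * K * A₁ ^ 2 ≤ A₀ ^ 2) (hlam : 0 ≤ lam) (hμ : lam ≤ μ) :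
    Real.exp (-(1 / 4 * (1 / gj ^ 2) * K⁻¹ * (μ * εj) ^ 2)) ≤ Real.exp (-(lam ^ 2 * (A₁ ^ 2 * p₀gj ^ 2))) := by
  have hε' : μ * εj = gj * (μ * A₀) * p₀gj := by rw [hε]; ring
  have h1 := prep381_chiΛ (A₁ := μ * A₁) hgj hK hε' (ratio_live μ hR3)
  refine h1.trans (Real.exp_le_exp.mpr (neg_le_neg ?_))
  have hsq : lam ^ 2 ≤ μ ^ 2 := pow_le_pow_left₀ hlam hμ 2
  have h0 : 0 ≤ A₁ ^ 2 * p₀gj ^ 2 := by positivity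
  calc lam ^ 2 * (A₁ ^ 2 * p₀gj ^ 2) ≤ μ ^ 2 * (A₁ ^ 2 * p₀gj ^ 2) := mul_le_mul_of_nonneg_right hsq h0
    _ = (μ * A₁) ^ 2 * p₀gj ^ 2 := by ring

/-! ## §3. pp. 380–381: the fundamental large-field factor of a component with live thresholds -/

/-- **[B16] pp. 380–381, the fundamental large-field factor of a component `Z_j^{(i)}`, LIVE**: with BOTH level-`j`
thresholds scaled by one `μ ∈ [λ₀, 1]` (`ε_j ↦ με_j`, `δ_j ↦ μδ_j`, as road (δ) does at a live level), the tree's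
`Lit.B16LargeFieldFactors380.fundamentalFactor_le` applies at the amplitudes `(μA₀, μA₁)`: the ledger relation
`2B₃²A₁² ≦ A₀²` is UNCHANGED (homogeneous) and the «g_j small» clause is asked once as `4 ≦ γ₀(λ₀A₁)²p₀(g_j)`; the product
of the three printed factors is then `≦ exp(−½γ₀(λ₀A₁)²p₀²(g_j)(d′_j(Z_j^{(i)}) + 1) − 2p₀(g_j))` — print's right member
with `A₁ ↦ λ₀A₁` and the bookkeeping term `−2p₀(g_j)` VERBATIM. [folklore] -/
theorem fundamentalFactor_le_live {dd : ℕ} {S : Finset (Pt dd)} (hS : S.Nonempty) (hc : FaceConnected S)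
    {γ₀ gj B₃ εj δj LM2R volP volQ volR A₀ A₁ p₀g lam₀ μ : ℝ} {d : ℕ} (hgj : gj ≠ 0) (hB₃ : B₃ ≠ 0)
    (hγ : 0 ≤ γ₀) (hp : 0 ≤ p₀g) (hε : εj = gj * A₀ * p₀g) (hδ : δj = gj * A₁ * p₀g)
    (hP : 0 ≤ (LM2R ^ d)⁻¹ * volP) (hQ : 0 ≤ (LM2R ^ 2)⁻¹ * volQ) (hR : 0 ≤ (LM2R ^ d)⁻¹ * volR)
    (hcover : (S.card : ℝ) ≤ (LM2R ^ d)⁻¹ * volP + (LM2R ^ 2)⁻¹ * volQ + (LM2R ^ d)⁻¹ * volR)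
    (hR2 : 2 * B₃ ^ 2 * A₁ ^ 2 ≤ A₀ ^ 2) (h0 : 0 ≤ lam₀) (hμ : lam₀ ≤ μ)
    (hsmall : 4 ≤ γ₀ * (lam₀ * A₁) ^ 2 * p₀g) :
    Real.exp (-expP γ₀ gj B₃ (μ * εj) LM2R d volP) * Real.exp (-expQ γ₀ gj (μ * δj) LM2R volQ) *
        Real.exp (-expR γ₀ gj (μ * δj) LM2R d volR) ≤
      Real.exp (-(1 / 2 * γ₀ * (lam₀ * A₁) ^ 2 * p₀g ^ 2 * (treeLen S + 1)) - 2 * p₀g) := by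
  have hε' : μ * εj = gj * (μ * A₀) * p₀g := by rw [hε]; ring
  have hδ' : μ * δj = gj * (μ * A₁) * p₀g := by rw [hδ]; ring
  have hsmall' : 4 ≤ γ₀ * (μ * A₁) ^ 2 * p₀g := clause_live hγ hp h0 hμ hsmall
  have h1 := fundamentalFactor_le hS hc hgj hB₃ hγ hp hε' hδ' hP hQ hR hcover (ratio_live μ hR2) hsmall'
  refine h1.trans (Real.exp_le_exp.mpr ?_)
  have hsq : (lam₀ * A₁) ^ 2 ≤ (μ * A₁) ^ 2 := by
    rw [mul_pow, mul_pow]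
    exact mul_le_mul_of_nonneg_right (pow_le_pow_left₀ h0 hμ 2) (sq_nonneg _)
  have hw : 0 ≤ 1 / 2 * γ₀ * p₀g ^ 2 * (treeLen S + 1) := by
    have := treeLen_nonneg S
    positivity
  have key : 1 / 2 * γ₀ * (lam₀ * A₁) ^ 2 * p₀g ^ 2 * (treeLen S + 1) ≤
      1 / 2 * γ₀ * (μ * A₁) ^ 2 * p₀g ^ 2 * (treeLen S + 1) := by
    have := mul_le_mul_of_nonneg_left hsq hw
    calc 1 / 2 * γ₀ * (lam₀ * A₁) ^ 2 * p₀g ^ 2 * (treeLen S + 1)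
        = 1 / 2 * γ₀ * p₀g ^ 2 * (treeLen S + 1) * (lam₀ * A₁) ^ 2 := by ring
      _ ≤ 1 / 2 * γ₀ * p₀g ^ 2 * (treeLen S + 1) * (μ * A₁) ^ 2 := this
      _ = 1 / 2 * γ₀ * (μ * A₁) ^ 2 * p₀g ^ 2 * (treeLen S + 1) := by ring
  linarith

/-! ## §4. p. 383: the factor after (1.78) and the exponent proviso, with a live fluctuation threshold -/

/-- **[B16] p. 383, the display after (1.78), LIVE**: the selected bond satisfies `|B(b)| ≧ g_j⁻¹(μδ′_j) = μ·A₁p₁(g_j)`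
at the lowered threshold, so (1.77)–(1.78) (`Lit.B16Sect1Kernels.form_lower_of_large_bond` with `a = μA₁p₁(g_j)`) yield
the factor `exp(−½γ₀W⁻¹A₁²(μp₁(g_j))²)`, and print's comparison `… < exp(−R_j^{−d−5}(μp₁(g_j))²)` holds under the SAME,
`μ`-FREE largeness of `R_j` as the printed one (`Lit.B16Sect1Kernels.lfFactor178_of_large`, corrected reading
`p₁ ↦ p₁²` of the left exponent, cell D-b02.7). [folklore] -/
theorem lfFactor178_live {γ₀ A₁ p₁g Rj M L Nβ μ : ℝ} {d : ℕ} (hRj : 0 < Rj) (hp : p₁g ≠ 0) (hμ : μ ≠ 0)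
    (hbase : 0 < 100 * M * (L + 1) * Nβ)
    (hlarge : 12 * (d + 3) * (100 * M * (L + 1) * Nβ) ^ (d + 2) < γ₀ * A₁ ^ 2 * Rj ^ 3) :
    lfFactor178 γ₀ (6 * (d + 3) * (100 * M * (L + 1) * Nβ * Rj) ^ (d + 2)) A₁ ((μ * p₁g) ^ 2) (μ * p₁g) Rj d :=
  lfFactor178_of_large hRj (mul_ne_zero hμ hp) hbase hlarge

/-- Real powers of real powers with a natural outer exponent: `(ℓ^a)^n = ℓ^{n·a}` (`ℓ ≥ 0`). [folklore] -/
private theorem rpow_pow_eq {ℓ : ℝ} (hℓ : 0 ≤ ℓ) (a : ℝ) (n : ℕ) : (ℓ ^ a) ^ n = ℓ ^ ((n : ℝ) * a) := by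
  rw [← Real.rpow_natCast (ℓ ^ a) n, ← Real.rpow_mul hℓ, mul_comm]

/-- **[B16] p. 383, the exponent proviso read with the live factor** («We assume that 2p₁ − (d + 5)r₀ > p₀, and we
estimate the factors by exp(−p₀(g_j))»): with `ℓ = log g_j⁻² ≥ 1`, profiles `p₀(g_j) = A₀ℓ^{p₀}`, `p₁(g_j) = A₁ℓ^{p₁}`
([III] (2.4), amplitudes INCLUDED), the (2.5) bracket `ℓ^{r₀} ≦ R_j ≦ Lℓ^{r₀}` (`Lit.B16Sect1SmallFactors.dict_of_isRj`)
and a live factor `μ ≥ λ₀ > 0`, the STRICT proviso leaves the room `ℓ^{σ}`, `σ = 2p₁ − (d+5)r₀ − p₀ > 0`, which absorbs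
ALL the constants at once — `λ₀²` together with `A₀∕A₁²` and `L^{d+5}` —: if `A₀L^{d+5} ≦ λ₀²A₁²ℓ^{σ}` («g_j sufficiently
small», now depending on `λ₀`), then `p₀(g_j) ≦ R_j^{−d−5}(μp₁(g_j))²`.  Generalises the tree's
`Lit.B16Sect1Kernels.exp_lfFactor_le_exp_neg_p0` (`A₀ = A₁ = 1`, `R_j = ℓ^{r₀}` exactly, `μ = 1`, which uses only the
NON-strict proviso). [folklore] -/
theorem margin383_live {ℓ p₀ p₁ r₀ σ A₀ A₁ p₀g p₁g Rj L lam₀ μ : ℝ} {d : ℕ} (hℓ : 1 ≤ ℓ) (hA₁ : 0 < A₁)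
    (hL : 1 ≤ L) (hp₀ : p₀g = A₀ * ℓ ^ p₀) (hp₁ : p₁g = A₁ * ℓ ^ p₁) (hRlo : ℓ ^ r₀ ≤ Rj)
    (hRhi : Rj ≤ L * ℓ ^ r₀) (hσ : σ + p₀ = 2 * p₁ - (d + 5) * r₀) (h0 : 0 < lam₀) (hμ : lam₀ ≤ μ)
    (hir : A₀ * L ^ (d + 5) ≤ lam₀ ^ 2 * A₁ ^ 2 * ℓ ^ σ) :
    p₀g ≤ (Rj ^ (d + 5))⁻¹ * (μ * p₁g) ^ 2 := by
  have hℓ0 : 0 < ℓ := by linarith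
  have hℓr : 0 < ℓ ^ r₀ := Real.rpow_pos_of_pos hℓ0 r₀
  have hRj : 0 < Rj := lt_of_lt_of_le hℓr hRlo
  have hL0 : 0 < L := by linarith
  have hLd : 0 < L ^ (d + 5) := pow_pos hL0 _
  -- the (2.5) bracket: `R_j^{d+5} ≤ L^{d+5} ℓ^{(d+5)r₀}`
  have hR5 : Rj ^ (d + 5) ≤ L ^ (d + 5) * ℓ ^ ((d + 5) * r₀) := by
    calc Rj ^ (d + 5) ≤ (L * ℓ ^ r₀) ^ (d + 5) := pow_le_pow_left₀ hRj.le hRhi _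
      _ = L ^ (d + 5) * (ℓ ^ r₀) ^ (d + 5) := mul_pow _ _ _
      _ = L ^ (d + 5) * ℓ ^ ((d + 5) * r₀) := by
          rw [rpow_pow_eq hℓ0.le r₀ (d + 5)]
          push_cast
          ring_nf
  -- the live threshold: `(μ p₁(g_j))² ≥ λ₀² A₁² ℓ^{2p₁}`
  have hsq : lam₀ ^ 2 * (A₁ ^ 2 * ℓ ^ (2 * p₁)) ≤ (μ * p₁g) ^ 2 := by
    have e : (μ * p₁g) ^ 2 = μ ^ 2 * (A₁ ^ 2 * ℓ ^ (2 * p₁)) := by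
      rw [hp₁, mul_pow, mul_pow, rpow_pow_eq hℓ0.le p₁ 2]
      push_cast
      ring
    rw [e]
    exact mul_le_mul_of_nonneg_right (pow_le_pow_left₀ h0.le hμ 2)
      (mul_nonneg (sq_nonneg _) (Real.rpow_nonneg hℓ0.le _))
  -- the room: `ℓ^{σ}·ℓ^{p₀} = ℓ^{2p₁} / ℓ^{(d+5)r₀}`
  have hsplit : ℓ ^ σ * ℓ ^ p₀ = ℓ ^ (2 * p₁) / ℓ ^ ((d + 5) * r₀) := by
    rw [← Real.rpow_add hℓ0, hσ, Real.rpow_sub hℓ0]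
  have hir' : A₀ ≤ lam₀ ^ 2 * A₁ ^ 2 * ℓ ^ σ / L ^ (d + 5) := by
    rw [le_div_iff₀ hLd]; exact hir
  have hnum : 0 ≤ lam₀ ^ 2 * (A₁ ^ 2 * ℓ ^ (2 * p₁)) :=
    mul_nonneg (sq_nonneg _) (mul_nonneg (sq_nonneg _) (Real.rpow_nonneg hℓ0.le _))
  have hden : 0 < ℓ ^ ((d + 5) * r₀) := Real.rpow_pos_of_pos hℓ0 _
  calc p₀g = A₀ * ℓ ^ p₀ := hp₀
    _ ≤ (lam₀ ^ 2 * A₁ ^ 2 * ℓ ^ σ / L ^ (d + 5)) * ℓ ^ p₀ :=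
        mul_le_mul_of_nonneg_right hir' (Real.rpow_nonneg hℓ0.le _)
    _ = lam₀ ^ 2 * A₁ ^ 2 * (ℓ ^ σ * ℓ ^ p₀) / L ^ (d + 5) := by ring
    _ = lam₀ ^ 2 * (A₁ ^ 2 * ℓ ^ (2 * p₁)) / (L ^ (d + 5) * ℓ ^ ((d + 5) * r₀)) := by
        rw [hsplit]
        field_simp
    _ ≤ lam₀ ^ 2 * (A₁ ^ 2 * ℓ ^ (2 * p₁)) / Rj ^ (d + 5) :=
        div_le_div_of_nonneg_left hnum (pow_pos hRj _) hR5
    _ ≤ (μ * p₁g) ^ 2 / Rj ^ (d + 5) := div_le_div_of_nonneg_right hsq (pow_pos hRj _).le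
    _ = (Rj ^ (d + 5))⁻¹ * (μ * p₁g) ^ 2 := by rw [div_eq_mul_inv, mul_comm]

/-- … hence the kept factor: `exp(−R_j^{−d−5}(μp₁(g_j))²) ≦ exp(−p₀(g_j))` — *"and we estimate the factors by
exp(−p₀(g_j))"*, read with the live factor. [folklore] -/
theorem exp_neg_p0_of_proviso_live {ℓ p₀ p₁ r₀ σ A₀ A₁ p₀g p₁g Rj L lam₀ μ : ℝ} {d : ℕ} (hℓ : 1 ≤ ℓ)
    (hA₁ : 0 < A₁) (hL : 1 ≤ L) (hp₀ : p₀g = A₀ * ℓ ^ p₀) (hp₁ : p₁g = A₁ * ℓ ^ p₁) (hRlo : ℓ ^ r₀ ≤ Rj)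
    (hRhi : Rj ≤ L * ℓ ^ r₀) (hσ : σ + p₀ = 2 * p₁ - (d + 5) * r₀) (h0 : 0 < lam₀) (hμ : lam₀ ≤ μ)
    (hir : A₀ * L ^ (d + 5) ≤ lam₀ ^ 2 * A₁ ^ 2 * ℓ ^ σ) :
    Real.exp (-((Rj ^ (d + 5))⁻¹ * (μ * p₁g) ^ 2)) ≤ Real.exp (-p₀g) :=
  Real.exp_le_exp.mpr (neg_le_neg (margin383_live hℓ hA₁ hL hp₀ hp₁ hRlo hRhi hσ h0 hμ hir))

/-- The closed-form INFRARED THRESHOLD of the live margin: for `σ > 0` and `c ≥ 0`, `ℓ ≧ c^{1∕σ}` gives `c ≦ ℓ^{σ}`;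
with `c = A₀L^{d+5}∕(λ₀²A₁²)` this is `margin383_live`'s hypothesis `hir` — ONE smallness of `g_j` depending on the
slack `λ₀ = 1 − β′` (and print's constants) only, uniform in the live factor. [folklore] -/
theorem ir383_of_ell_ge {ℓ σ c : ℝ} (hσ : 0 < σ) (hc : 0 ≤ c) (hℓ : c ^ (1 / σ) ≤ ℓ) : c ≤ ℓ ^ σ := by
  have h1 : (c ^ (1 / σ)) ^ σ ≤ ℓ ^ σ := Real.rpow_le_rpow (Real.rpow_nonneg hc _) hℓ hσ.le
  rwa [← Real.rpow_mul hc, one_div_mul_cancel hσ.ne', Real.rpow_one] at h1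

/-- **HEADLINE — [B16] p. 383 read with road (δ)'s live factor, in print's letters.**  Let `R_j` be given by (2.5)
[III] (`Lit.B14.IsRj L r g_j R_j`, `L ≥ 1`), the profiles by (2.4) [III] (`Lit.p0Profile A p g = A(log g⁻²)^p`, `A₀,
A₁ > 0`), and let the exponents satisfy the printed STRICT proviso `2p₁ − (d + 5)r > p₀`
(`Lit.B16Sect1Kernels.ExponentProviso383`).  Then for every slack `λ₀ > 0` there is `g₀ = g₀(λ₀, A₀, A₁, L, d, p₀, p₁, r)
> 0` — explicitly `exp(−½·max{1, (A₀L^{d+5}∕(λ₀²A₁²))^{1∕σ}})` — such that for all `0 < g_j ≦ g₀` and ALL live factors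
`μ ≥ λ₀` the lowered-threshold factor is still estimated by print's kept factor:
`exp(−R_j^{−d−5}(μ·p₁(g_j))²) ≦ exp(−p₀(g_j))`.  This is census class C1 of `HOME/ne/NE7c.md` §7 (rows 14∕16∕17) as a
kernel statement at its margin locus; the `∀ c`-binders of `Lit.T4ShellMeasureSocket.hybridNE7_tail_of_liveFactor` ask
exactly this uniformity of the single-run bounds. [folklore] -/
theorem liveFactor383_of_g_small {L r p₀ p₁ d : ℕ} {A₀ A₁ lam₀ : ℝ} (hL : 1 ≤ L) (hA₀ : 0 < A₀) (hA₁ : 0 < A₁)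
    (h0 : 0 < lam₀) (hprov : ExponentProviso383 p₀ p₁ r d) :
    ∃ g₀ : ℝ, 0 < g₀ ∧ ∀ (gj μ : ℝ) (Rj : ℕ), 0 < gj → gj ≤ g₀ → B14.IsRj L r gj Rj → lam₀ ≤ μ →
      Real.exp (-(((Rj : ℝ) ^ (d + 5))⁻¹ * (μ * p0Profile A₁ p₁ gj) ^ 2)) ≤ Real.exp (-p0Profile A₀ p₀ gj) := by
  unfold ExponentProviso383 at hprov
  set σ : ℝ := 2 * (p₁ : ℝ) - ((d : ℝ) + 5) * (r : ℝ) - (p₀ : ℝ) with hσdef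
  have hσ : 0 < σ := by rw [hσdef]; linarith
  set c : ℝ := A₀ * (L : ℝ) ^ (d + 5) / (lam₀ ^ 2 * A₁ ^ 2) with hcdef
  have hden : 0 < lam₀ ^ 2 * A₁ ^ 2 := by positivity
  have hL' : (1 : ℝ) ≤ (L : ℝ) := by exact_mod_cast hL
  have hc : 0 ≤ c := by rw [hcdef]; positivity
  set ℓ₀ : ℝ := max 1 (c ^ (1 / σ)) with hℓ₀def
  refine ⟨Real.exp (-(ℓ₀ / 2)), Real.exp_pos _, fun gj μ Rj hg0 hg hR hμ => ?_⟩
  have hℓ : ℓ₀ ≤ Real.log (gj ^ 2)⁻¹ := B16Sect1SmallFactors.ell_ge_of_g_le hg0 hg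
  have hℓ1 : 1 ≤ Real.log (gj ^ 2)⁻¹ := le_trans (le_max_left _ _) hℓ
  obtain ⟨hRlo, hRhi⟩ := B16Sect1SmallFactors.dict_of_isRj hL hR hℓ1
  have hp₀ : p0Profile A₀ p₀ gj = A₀ * (Real.log (gj ^ 2)⁻¹) ^ (p₀ : ℝ) := by
    rw [p0Profile, Real.rpow_natCast]
  have hp₁ : p0Profile A₁ p₁ gj = A₁ * (Real.log (gj ^ 2)⁻¹) ^ (p₁ : ℝ) := by
    rw [p0Profile, Real.rpow_natCast]
  have hroom : c ≤ (Real.log (gj ^ 2)⁻¹) ^ σ :=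
    ir383_of_ell_ge hσ hc (le_trans (le_max_right _ _) hℓ)
  have hir : A₀ * (L : ℝ) ^ (d + 5) ≤ lam₀ ^ 2 * A₁ ^ 2 * (Real.log (gj ^ 2)⁻¹) ^ σ := by
    have := mul_le_mul_of_nonneg_left hroom hden.le
    rw [hcdef, mul_div_cancel₀ _ hden.ne'] at this
    exact this
  have hσ' : σ + (p₀ : ℝ) = 2 * (p₁ : ℝ) - ((d : ℝ) + 5) * (r : ℝ) := by rw [hσdef]; ring
  exact exp_neg_p0_of_proviso_live hℓ1 hA₁ hL' hp₀ hp₁ hRlo hRhi hσ' h0 hμ hir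

/-! ## §5. Sanity -/

/-- SANITY: the strict proviso is inhabited in `d = 4` — `p₀ = 2`, `p₁ = 6`, `r = 1`: `2 < 12 − 9`. [folklore] -/
example : ExponentProviso383 2 6 1 4 := by
  unfold ExponentProviso383; norm_num

end

end Summit.QuantumFields.BalabanUV.T4Continuum.Spine.NE7c.LiveFactorLargeField
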